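import Summits.QuantumFields.YangMills.Theorems.FemtoTransferGapPhysL2Infinite
import Summits.QuantumFields.YangMills.Theorems.LuscherReductionRunningReductionLatticeLinkKernel
import Summits.QuantumFields.YangMills.Theorems.LuscherReductionDressedRitzPolyakovLiftTransplantDilation
import HarnessLib

/-!
# A non-zero admissible tube state: the continuous action cut-off and its square
# (support item `TubeMaximiser` of route `FlatTubeReduction`, stmt-QuantumFields-24923 — the non-triviality half; rung R2b1 = RECORD femto gap)

Seat `ym-line-sfw-p1` g9 (prover; planner-of-record ym-idea-1).  For the maximiser of the Rayleigh quotient of the zero-flux transfer form over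
`V = {tube-supported physical ψ ⊥ Ω}` to exist one needs `V ≠ {0}` for EVERY tube width `η > 0`, every `L ≥ 1` and every physical `Ω`.
Witness: the continuous cut-off `c_η = (η − S)₊` (`S` the Wilson action) and its square are physical, vanish off the tube `{S ≤ η}`, and are
linearly independent as functions — `c_η = η` at the trivial configuration and `0 < c_η < η` at a two-link configuration
`twoLinkCfg (chartSU2 (t e₀)) (chartSU2 (t e₁))` with `t` small (its action is `> 0` and `≤ |P|·4t⁴`) — hence some non-trivial combination is
`⊥ Ω`, and it is non-zero in `L²` because the a-priori measure charges open sets (`coe_eq_zero_of_toL2_eq_zero`).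

* §1 `isPhys_tubeCutoff`, `isPhys_tubeCutoff_sq`, continuity, support;
* §2 `wilsonAction_constOne` (`S(1) = 0`), `wilsonAction_twoLinkCfg_le` / `_ge` (every plaquette holonomy of a two-link configuration is
  the commutator or `1`), `scalarPart_comm_chart` (`= 1 − 2t⁴`);
* §3 ★ `exists_tube_witness`: a continuous physical `ψ ⊥ Ω`, vanishing where `η < S`, with `0 < ‖ψ‖²`.

HONEST FRAMING: elementary fixed-lattice bookkeeping; nothing about infinite volume, the continuum or the Clay Yang–Mills gap.
No definitions, no named facts, no `sorry`.
-/

set_option autoImplicit false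

noncomputable section

open MeasureTheory Filter Topology Real
open scoped Matrix
open Literature.MathematicalPhysics.QuantumFieldTheory
open Literature.MathematicalPhysics.QuantumLattice

namespace Summit.QuantumFields.YangMills.Theorems.FemtoTransferGap

namespace TubeMax

open Summit.QuantumFields.YangMills.Theorems.FemtoTransferGap.PhysL2

variable {L : ℕ} [NeZero L]

/-! ## §1 The continuous action cut-off `(η − S)₊` -/

/-- `(η − S)₊` is continuous. [folklore] -/
theorem continuous_tubeCutoff (η : ℝ) : Continuous fun U : GaugeConfig 3 L SU2 => max (η - wilsonAction su2Rep U) 0 :=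
  (continuous_const.sub (continuous_wilsonAction su2Rep (d := 3) (L := L) continuous_su2Rep)).max continuous_const

/-- `0 ≤ (η − S)₊ ≤ η` for `η ≥ 0` (the action is non-negative). [folklore] -/
theorem tubeCutoff_mem {η : ℝ} (hη : 0 ≤ η) (U : GaugeConfig 3 L SU2) :
    0 ≤ max (η - wilsonAction su2Rep U) 0 ∧ max (η - wilsonAction su2Rep U) 0 ≤ η := by
  refine ⟨le_max_right _ _, max_le ?_ hη⟩
  linarith [wilsonAction_su2_nonneg_lat U]

/-- `(η − S)₊` vanishes where `η < S` (indeed where `η ≤ S`). [folklore] -/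
theorem tubeCutoff_eq_zero {η : ℝ} {U : GaugeConfig 3 L SU2} (h : η ≤ wilsonAction su2Rep U) :
    max (η - wilsonAction su2Rep U) 0 = 0 :=
  max_eq_right (by linarith)

/-- **`(η − S)₊` is a physical zero-flux test function** (continuous, bounded by `η`, gauge and twist invariant with the action). [folklore] -/
theorem isPhys_tubeCutoff {η : ℝ} (hη : 0 ≤ η) : IsPhys (fun U : GaugeConfig 3 L SU2 => max (η - wilsonAction su2Rep U) 0) where
  measurable := (continuous_tubeCutoff η).measurable
  bounded := ⟨η, fun U => by
    rw [abs_of_nonneg (tubeCutoff_mem hη U).1]; exact (tubeCutoff_mem hη U).2⟩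
  gaugeInv := fun g U => by simp only [wilsonAction_gaugeTransform]
  zeroFlux := fun k z hz U => by simp only [wilsonAction_twist_of_mem_center su2Rep k hz U]

/-- **`(η − S)₊²` is a physical zero-flux test function.** [folklore] -/
theorem isPhys_tubeCutoff_sq {η : ℝ} (hη : 0 ≤ η) : IsPhys (fun U : GaugeConfig 3 L SU2 => max (η - wilsonAction su2Rep U) 0 ^ 2) where
  measurable := (continuous_tubeCutoff η).measurable.pow_const 2
  bounded := ⟨η ^ 2, fun U => by
    rw [abs_of_nonneg (sq_nonneg _)]
    exact pow_le_pow_left₀ (tubeCutoff_mem hη U).1 (tubeCutoff_mem hη U).2 2⟩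
  gaugeInv := fun g U => by simp only [wilsonAction_gaugeTransform]
  zeroFlux := fun k z hz U => by simp only [wilsonAction_twist_of_mem_center su2Rep k hz U]

/-! ## §2 Two configurations: the trivial one and a small two-link one -/

/-- Each plaquette term of the `SU(2)` Wilson action is `2 − 2·scalarPart` of the holonomy. [folklore] -/
theorem plaquetteTerm_eq (g : SU2) : ((2 : ℕ) : ℝ) - ((su2Rep g).trace).re = 2 - 2 * scalarPart g := by
  simp only [fundamentalRep_apply, Nat.cast_ofNat, re_trace_eq_two_mul_scalarPart]

/-- `S(1) = 0`: the trivial configuration has zero action. [folklore] -/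
theorem wilsonAction_constOne : wilsonAction su2Rep (fun _ : Edge 3 L => (1 : SU2)) = 0 := by
  unfold wilsonAction
  refine Finset.sum_eq_zero fun p _ => ?_
  have h : plaquetteHolonomy (fun _ : Edge 3 L => (1 : SU2)) p.1 p.2.1.1 p.2.1.2 = 1 := by
    simp [plaquetteHolonomy]
  rw [h, plaquetteTerm_eq, PolyakovLift.scalarPart_one, mul_one, sub_self]

omit [NeZero L] in
/-- Every plaquette holonomy of a two-link configuration is the commutator `a b a⁻¹ b⁻¹` (the `(0,1)` plaquettes) or `1` (the `(0,2)` and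
`(1,2)` plaquettes). [folklore] -/
theorem plaquetteHolonomy_twoLinkCfg_cases (a b : SU2) (p : Plaquette 3 L) :
    plaquetteHolonomy (twoLinkCfg (L := L) a b) p.1 p.2.1.1 p.2.1.2 = a * b * a⁻¹ * b⁻¹ ∨
      plaquetteHolonomy (twoLinkCfg (L := L) a b) p.1 p.2.1.1 p.2.1.2 = 1 := by
  obtain ⟨x, ⟨i, j⟩, hij⟩ := p
  fin_cases i <;> fin_cases j
  all_goals first
    | exact absurd hij (by decide)
    | simp [plaquetteHolonomy, twoLinkCfg]

/-- Upper bound: `S(twoLinkCfg a b) ≤ |P| · (2 − 2·scalarPart(a b a⁻¹ b⁻¹))`. [folklore] -/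
theorem wilsonAction_twoLinkCfg_le (a b : SU2) :
    wilsonAction su2Rep (twoLinkCfg (L := L) a b) ≤ Fintype.card (Plaquette 3 L) * (2 - 2 * scalarPart (a * b * a⁻¹ * b⁻¹)) := by
  unfold wilsonAction
  have hle : ∀ p ∈ (Finset.univ : Finset (Plaquette 3 L)),
      ((2 : ℕ) : ℝ) - ((su2Rep (plaquetteHolonomy (twoLinkCfg (L := L) a b) p.1 p.2.1.1 p.2.1.2)).trace).re ≤
        2 - 2 * scalarPart (a * b * a⁻¹ * b⁻¹) := by
    intro p _
    rw [plaquetteTerm_eq]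
    rcases plaquetteHolonomy_twoLinkCfg_cases a b p with h | h
    · rw [h]
    · rw [h, PolyakovLift.scalarPart_one]
      have := abs_scalarPart_le (a * b * a⁻¹ * b⁻¹)
      rw [abs_le] at this
      linarith
  calc ∑ p : Plaquette 3 L, (((2 : ℕ) : ℝ) - ((su2Rep (plaquetteHolonomy (twoLinkCfg (L := L) a b) p.1 p.2.1.1 p.2.1.2)).trace).re)
      ≤ ∑ _p : Plaquette 3 L, (2 - 2 * scalarPart (a * b * a⁻¹ * b⁻¹)) := Finset.sum_le_sum hle
    _ = Fintype.card (Plaquette 3 L) * (2 - 2 * scalarPart (a * b * a⁻¹ * b⁻¹)) := by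
        rw [Finset.sum_const, Finset.card_univ, nsmul_eq_mul]

/-- Lower bound: `2 − 2·scalarPart(a b a⁻¹ b⁻¹) ≤ S(twoLinkCfg a b)` (the single `(0,1)` plaquette at the origin). [folklore] -/
theorem wilsonAction_twoLinkCfg_ge (a b : SU2) :
    2 - 2 * scalarPart (a * b * a⁻¹ * b⁻¹) ≤ wilsonAction su2Rep (twoLinkCfg (L := L) a b) := by
  unfold wilsonAction
  set p₀ : Plaquette 3 L := ((0 : Site 3 L), ⟨((0 : Fin 3), (1 : Fin 3)), by decide⟩) with hp₀
  have hterm : ((2 : ℕ) : ℝ) - ((su2Rep (plaquetteHolonomy (twoLinkCfg (L := L) a b) p₀.1 p₀.2.1.1 p₀.2.1.2)).trace).re =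
      2 - 2 * scalarPart (a * b * a⁻¹ * b⁻¹) := by
    rw [plaquetteTerm_eq, hp₀]
    simp only
    rw [plaquetteHolonomy_twoLinkCfg]
  rw [← hterm]
  refine Finset.single_le_sum (f := fun p : Plaquette 3 L =>
    ((2 : ℕ) : ℝ) - ((su2Rep (plaquetteHolonomy (twoLinkCfg (L := L) a b) p.1 p.2.1.1 p.2.1.2)).trace).re) (fun p _ => ?_)
    (Finset.mem_univ p₀)
  rw [plaquetteTerm_eq]
  have := abs_scalarPart_le (plaquetteHolonomy (twoLinkCfg (L := L) a b) p.1 p.2.1.1 p.2.1.2)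
  rw [abs_le] at this
  linarith

/-- The commutator of the chart points `chartSU2 (t e₀)`, `chartSU2 (t e₁)` has scalar part `1 − 2t⁴` (`0 ≤ t ≤ 1`). [folklore] -/
theorem scalarPart_comm_chart {t : ℝ} (ht : t ∈ Set.Icc (0 : ℝ) 1) :
    scalarPart (chartSU2 (Pi.single 0 t) * chartSU2 (Pi.single 1 t) * (chartSU2 (Pi.single 0 t))⁻¹ * (chartSU2 (Pi.single 1 t))⁻¹) =
      1 - 2 * t ^ 4 := by
  have ha' : ∑ c, (Pi.single (0 : Fin 3) t : Fin 3 → ℝ) c ^ 2 = t ^ 2 := by simp [Fin.sum_univ_three]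
  have hb' : ∑ c, (Pi.single (1 : Fin 3) t : Fin 3 → ℝ) c ^ 2 = t ^ 2 := by simp [Fin.sum_univ_three]
  have ht2 : t ^ 2 ≤ 1 := by nlinarith [ht.1, ht.2]
  have ha : ∑ c, (Pi.single (0 : Fin 3) t : Fin 3 → ℝ) c ^ 2 ≤ 1 := by rw [ha']; exact ht2
  have hb : ∑ c, (Pi.single (1 : Fin 3) t : Fin 3 → ℝ) c ^ 2 ≤ 1 := by rw [hb']; exact ht2
  rw [scalarPart_comm_eq, vecPart_chartSU2 ha, vecPart_chartSU2 hb]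
  simp [cross_apply, dotProduct, Fin.sum_univ_three]
  ring

/-- **A two-link configuration with action in `(0, η)`** for every `η > 0`. [folklore] -/
theorem exists_cfg_action_mem_Ioo {η : ℝ} (hη : 0 < η) :
    ∃ U : GaugeConfig 3 L SU2, 0 < wilsonAction su2Rep U ∧ wilsonAction su2Rep U < η := by
  set P : ℝ := (Fintype.card (Plaquette 3 L) : ℝ) with hP
  have hP0 : 0 ≤ P := by rw [hP]; positivity
  -- `t = min (1/2) (η / (8P + 8))`: then `4 P t⁴ ≤ 4 P t ≤ η/2 < η` and `t > 0`
  set t : ℝ := min (1 / 2) (η / (8 * P + 8)) with htdef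
  have ht0 : 0 < t := by rw [htdef]; exact lt_min (by norm_num) (by positivity)
  have ht1 : t ≤ 1 := (min_le_left _ _).trans (by norm_num)
  have htη : t ≤ η / (8 * P + 8) := min_le_right _ _
  have ht4 : t ^ 4 ≤ t := by
    have : t ^ 4 ≤ t ^ 1 := pow_le_pow_of_le_one ht0.le ht1 (by norm_num)
    rwa [pow_one] at this
  refine ⟨twoLinkCfg (chartSU2 (Pi.single 0 t)) (chartSU2 (Pi.single 1 t)), ?_, ?_⟩
  · refine lt_of_lt_of_le ?_ (wilsonAction_twoLinkCfg_ge _ _)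
    rw [scalarPart_comm_chart ⟨ht0.le, ht1⟩]
    nlinarith [pow_pos ht0 4]
  · refine lt_of_le_of_lt (wilsonAction_twoLinkCfg_le _ _) ?_
    rw [scalarPart_comm_chart ⟨ht0.le, ht1⟩, ← hP]
    have h1 : P * (2 - 2 * (1 - 2 * t ^ 4)) = 4 * P * t ^ 4 := by ring
    rw [h1]
    have h2 : 4 * P * t ^ 4 ≤ 4 * P * t := mul_le_mul_of_nonneg_left ht4 (by positivity)
    have h3 : 4 * P * t ≤ 4 * P * (η / (8 * P + 8)) := mul_le_mul_of_nonneg_left htη (by positivity)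
    have h4 : 4 * P * (η / (8 * P + 8)) < η := by
      rw [mul_div_assoc', div_lt_iff₀ (by positivity)]
      nlinarith
    linarith

/-! ## §3 The witness -/

/-- ★ **A non-zero admissible tube state.**  For every `η > 0`, every `L ≥ 1` and every physical `Ω` there is a CONTINUOUS physical
zero-flux test function `ψ` with `ψ ⊥ Ω`, `ψ = 0` wherever `η < S`, and `0 < ‖ψ‖²`: a combination of `(η − S)₊` and `(η − S)₊²`.
[cite: ReedSimonIV1978, Thm. XIII.1] -/
theorem exists_tube_witness {η : ℝ} (hη : 0 < η) {Ω : GaugeConfig 3 L SU2 → ℝ} (hΩ : IsPhys Ω) :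
    ∃ ψ : GaugeConfig 3 L SU2 → ℝ, IsPhys ψ ∧ Continuous ψ ∧ l2 ψ Ω = 0 ∧
      (∀ U, η < wilsonAction su2Rep U → ψ U = 0) ∧ 0 < l2 ψ ψ := by
  -- the two cut-offs
  set f₁ : GaugeConfig 3 L SU2 → ℝ := fun U => max (η - wilsonAction su2Rep U) 0 with hf₁
  set f₂ : GaugeConfig 3 L SU2 → ℝ := fun U => max (η - wilsonAction su2Rep U) 0 ^ 2 with hf₂
  have hF₁ : IsPhys f₁ := isPhys_tubeCutoff hη.le
  have hF₂ : IsPhys f₂ := isPhys_tubeCutoff_sq hη.le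
  have hc₁ : Continuous f₁ := continuous_tubeCutoff η
  have hc₂ : Continuous f₂ := (continuous_tubeCutoff η).pow 2
  -- coefficients making the combination orthogonal to `Ω`, not both zero
  set m₁ := l2 f₁ Ω with hm₁
  set m₂ := l2 f₂ Ω with hm₂
  obtain ⟨a, b, hab, horth⟩ : ∃ a b : ℝ, (a ≠ 0 ∨ b ≠ 0) ∧ a * m₁ + b * m₂ = 0 := by
    by_cases h : m₁ = 0 ∧ m₂ = 0
    · exact ⟨1, 0, Or.inl one_ne_zero, by rw [h.1, h.2]; ring⟩
    · rw [not_and_or] at h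
      rcases h with h | h
      · exact ⟨m₂, -m₁, Or.inr (neg_ne_zero.2 h), by ring⟩
      · exact ⟨m₂, -m₁, Or.inl h, by ring⟩
  set ψ : GaugeConfig 3 L SU2 → ℝ := a • f₁ + b • f₂ with hψdef
  have hψ : IsPhys ψ := (hF₁.smul a).add (hF₂.smul b)
  have hψc : Continuous ψ := (hc₁.const_smul a).add (hc₂.const_smul b)
  have hψapply : ∀ U, ψ U = a * f₁ U + b * f₂ U := fun U => by
    simp only [hψdef, Pi.add_apply, Pi.smul_apply, smul_eq_mul]
  refine ⟨ψ, hψ, hψc, ?_, fun U hU => ?_, ?_⟩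
  · -- orthogonality
    rw [hψdef, l2_add_left (hF₁.smul a) (hF₂.smul b) hΩ, l2_smul_left, l2_smul_left]
    exact horth
  · -- support
    have h0 : max (η - wilsonAction su2Rep U) 0 = 0 := tubeCutoff_eq_zero hU.le
    rw [hψapply]
    simp only [hf₁, hf₂, h0]
    ring
  · -- non-vanishing: if `‖ψ‖² = 0` then `ψ ≡ 0` (continuity, full support), contradicting the values at `1` and at a small two-link configuration
    rcases (l2_self_nonneg ψ).eq_or_lt with h0 | hpos
    · exfalso
      have hz : toL2 (⟨ψ, hψ⟩ : physSubmodule L) = 0 := by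
        rw [← norm_eq_zero, ← sq_eq_zero_iff, norm_sq_toL2]
        exact h0.symm
      have hzero : ψ = 0 := coe_eq_zero_of_toL2_eq_zero (ψ := ⟨ψ, hψ⟩) hψc hz
      -- evaluate at the trivial configuration: `a η + b η² = 0`
      have e1 : a * η + b * η ^ 2 = 0 := by
        have h := congrFun hzero (fun _ => (1 : SU2))
        rw [hψapply, Pi.zero_apply] at h
        simp only [hf₁, hf₂, wilsonAction_constOne, sub_zero, max_eq_left hη.le] at h
        exact h
      -- evaluate at a configuration with `0 < S < η`: `a c + b c² = 0`, `0 < c < η`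
      obtain ⟨U₁, hS0, hSη⟩ := exists_cfg_action_mem_Ioo (L := L) hη
      set c := η - wilsonAction su2Rep U₁ with hc
      have hc0 : 0 < c := by rw [hc]; linarith
      have hcη : c < η := by rw [hc]; linarith
      have e2 : a * c + b * c ^ 2 = 0 := by
        have h := congrFun hzero U₁
        rw [hψapply, Pi.zero_apply] at h
        simp only [hf₁, hf₂] at h
        rw [← hc, max_eq_left hc0.le] at h
        exact h
      -- hence `a = b = 0`
      have e3 : a + b * η = 0 := by
        have : η * (a + b * η) = 0 := by linear_combination e1
        exact (mul_eq_zero.1 this).resolve_left hη.ne'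
      have e4 : a + b * c = 0 := by
        have : c * (a + b * c) = 0 := by linear_combination e2
        exact (mul_eq_zero.1 this).resolve_left hc0.ne'
      have hb : b = 0 := by
        have : b * (η - c) = 0 := by linear_combination e3 - e4
        exact (mul_eq_zero.1 this).resolve_right (by linarith)
      have ha : a = 0 := by rw [hb] at e3; linarith
      rcases hab with h | h
      · exact h ha
      · exact h hb
    · exact hpos

end TubeMax

end Summit.QuantumFields.YangMills.Theorems.FemtoTransferGap

end
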